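import Summits.QuantumFields.YangMills.Theorems.BalabanUVNodesN15KingModelGraphTreeDecayKing
import Summits.QuantumFields.YangMills.Theorems.BalabanUVNodesN15KingModelGraphTreeLength
import Summits.QuantumFields.YangMills.Theorems.BalabanUVNodesN15KingModelGraphPowerCountingRate

/-!
# BalabanUVNodes ∕ N15 — THE KING-MODEL RUNG (PART Α-e): **KING 1986 PROPOSITION 3.6 (3.56) WITH ITS EXPONENTIAL TREE DECAY, BY NAME AT `A = 0`** —
# part Γ-i's form of record `king_prop36_graph_zeroField_R` for CONNECTED graphs whose one-vertex factors are ANCHORED at external points with decaying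
# majorants, the bound multiplied by `exp[−min(δ₁, δ′)·treeLength({anchors})]`, King's «length of the shortest tree graph connecting» the external points
# (Track A, DAG node N15 = NE2; FAN-OUT v1.1 §N15 s3 «KING-MODEL RUNG … NE2's analogue DECIDED in the model»)

HONEST FRAMING.  Count-neutral (cell `pub-ymgap`, seat `pub-ymgap-dag-n15-e` g29; `--supports stmt-QuantumFields-27366 --as helper` = K3⁸
`SpineGivenEndpointR13SepCoPHV`).  TEMPLATE LITERATURE: C. King, *The U(1) Higgs model. I. The continuum limit*, Commun. Math. Phys. **102** (1986) 649–677
[King1986], Proposition 3.6 (3.56) p. 662 and its proof pp. 663–665, for KING's OWN `A = 0` MODEL (the `h = g = 0` slices of [Ba4] (1.6) = King (2.13)) on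
the rung's tori; Props. 3.7∕3.9 BY NAME (parts Ρ∕Χ∕Ω₂).  NOT Bałaban's non-abelian `G(U)` of [B9]; NOT a node discharge; nothing continuum ∕ ℝ⁴ ∕ OS ∕
mass-gap ∕ Clay.  0 `sorry`; standard axioms.  Text layer of pp. 660–665 (`paper:king1986-cmp102-king-u1-higgs-i` p0012–p0017) re-read by this seat 2026-08-29.

THE PRINT.  p. 662 [PDF 14], Proposition 3.6 (3.56): *«|E^{(k)}(H; {y_i}, {z_q}, {w_l}) − E^{(k+n)}(H; {y_i}, {z_q}, {w_l})| ≤ C(L^kε)^{…}·L^{−γk}·exp[−δ d(…, {y_i},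
{z_q}, {w_l})]»* (text layer damaged; the rate `L^{−γk}`, the vertex count power of `L^kε` and the tree decay are what pp. 663–665 prove); p. 660 [PDF 12]: *«We
define dist({u_i}) to be the length of the shortest tree graph connecting {u_i}»*; p. 664 [PDF 16]: *«By extracting a small part of each propagator, we get the
exponential decay on the right-hand side of (3.56).»*

READING (declared; ours).  Part Γ-i's theorem typed (3.56) as `|E^{(K+n)}(H) − E^{(K)}(H)| ≤ (Γ′ + Γ·(L^{−γK}(m+1) + Σ s))·C₁^m·C₂^{nn}·(m!·(1 − L^{−γ₁∕2})^{−m})·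
Π qq` for NUMBERED graphs whose external structure sits in abstract one-vertex factors `u_υ` (sups `qq_υ`, a root-placed `L¹` factor `υ₀` = King's `|□′|`),
WITHOUT the tree decay.  Here every one-vertex factor may be ANCHORED at an external point `y_υ` of the coarse torus (`anch υ = some y_υ`; `none` = unanchored)
and its majorant carries the decay `exp[−δ′|x − y_υ|]` of an external line (Thm 3.3 ∕ Prop. 3.8 give it; `|x − y| = tdistT∕L^K`, unit-block units); for a
CONNECTED graph the bound then gains the factor `exp[−min(δ₁, δ′)·treeLength({y_υ})]`, `δ₁` half the rate of Props. 3.7∕3.9 (one per Hölder exponent, here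
`α = ½`): every slice gives away a unit-scale `exp[−δ⋆|x − y|]` (part Α-c), every anchored leg likewise, and at every placement these multiply to at most
`exp[−δ⋆·treeLength]` (part Α-b) — `δ⋆ = min(δ₁, δ′)`.  `δ′ = 0` (or no anchors) recovers part Γ-i's bound with the constants of halved rates.

WHAT THIS FILE PROVES (namespace `Summit.QuantumFields.YangMills.BalabanUVNodes.N15KingModelRung.Curved`).
* `kingDist L jv` — the unit-block distance `tdistT∕L^K` on the rung's coarse torus (the `dist` of parts Ρ-e∕Ω₁'s slice data); `kingDist_nonneg`.
* ★★★ **`king_prop36_graph_zeroField_treeDecay_R`** — (3.56) WITH ITS TREE DECAY: one `(C₁, C₂, γ₀, δ₁)` for odd `L ≥ 3`, `a > 0`, `m₀² ≥ 0`, such that for every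
  mass, volume∕scale index, `n ≥ 1`, every CONNECTED numbered graph with kinds `κ`, anchors `anch`, leg rate `δ′ ≥ 0`, one-vertex data with anchored-decaying
  majorants (both lattices through King's pairing), `Γ, Γ′`, margin `γ₁ > 0` and certificates with partial degrees `> γ₁` along every ordering:
  `|E^{(K+n)}(H) − E^{(K)}(H)| ≤ exp[−min(δ₁, δ′)·treeLength (kingDist) (anchors)]·(Γ′ + Γ·(L^{−γK}(m+1) + Σ_{υ≠υ₀} s_υ))·C₁^m·C₂^{nn}·(m!·(1 − L^{−γ₁∕2})^{−m})·Π_{υ≠υ₀} qq_υ`.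
  ASSEMBLY = part Γ-i's, run on part Α-d's two halves with the weights `exp[−δ⋆|x − y|]` ∕ `legWeight δ⋆` and `Θ₀ = exp[−δ⋆·treeLength]` from part Α-b
  `prod_lineWeight_mul_prod_legWeight_le`; the generic cores (part Γ-h `sum_graphValLS_profileAt_le_R`, part Γ-e `replacement_line_term_le`,
  `sum_degConst_le_of_margin`) VERBATIM at the halved rates.

HONEST SCOPE.  (a) King's `A = 0` model; `G`∕`∂G` lines; positivity of the degrees along every ordering is a HYPOTHESIS (§3.5∕Thm 3.5 NOT typed; part Α-f
discharges it from p.664's subgraph condition as parts Γ-l∕Δ-b do); the certificates are user data (part Α-f: Kruskal's).  (b) `treeLength` minimises over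
connecting edge sets (= King's tree minimum by pruning, not typed); anchors and their decay rate `δ′` are the user's (external lines: Thm 3.3 (3.7), Prop. 3.8
(3.71) — not instantiated here).  (c) The vertex-count power `(L^kε)^{…}` of (3.56) is the user's `Γ` (King's `|□′|`), as in part Γ-i.  (d) NOT Bałaban's `G(U)`;
NE2 ∕ N15 untouched; counts unmoved.  Locators: [King1986] Prop. 3.6 (3.56) p.662, p.660 (tree length), pp.663–665 (proof), p.664 («extracting a small part»),
Prop. 3.7 (3.63) p.663, Prop. 3.9 (3.73) p.665, (3.77) p.666.
-/

noncomputable section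

namespace Summit.QuantumFields.YangMills.BalabanUVNodes.N15KingModelRung.Curved

open scoped BigOperators
open Finset
open Literature.MathematicalPhysics.QuantumFieldTheory.Balaban1983to89.B5Prop11Plancherel (Tor fine)
open Literature.MathematicalPhysics.QuantumFieldTheory.King1986.Torus (tdistT tdistT_nonneg)
open Literature.MathematicalPhysics.QuantumFieldTheory.King1986.SlicePropagator (SliceKernels TwoSpacing Prop37PrintedAt Prop39PrintedAt)
open Literature.MathematicalPhysics.QuantumFieldTheory.King1986.ContinuumLimit (eps)
open Summit.QuantumFields.YangMills.BalabanUVNodes.N15KingModelRung (KingVolIndex kingVol kingVol_neZero)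
open Summit.QuantumFields.YangMills.BalabanUVNodes.N15KingModelRung.Graph

variable {d : ℕ} (L : ℕ) [NeZero L]

section Prop36TreeDecay

/-- **THE UNIT-BLOCK DISTANCE ON THE RUNG's COARSE TORUS** `|x − y| = tdistT(x, y)∕L^K` (`η = L^{−K}`; the `dist` of the slice data of parts Ρ-e∕Ω₁, in which
Props. 3.7∕3.9 and the tree decay of (3.56) are measured). [cite: King1986, (3.14) p.657 («rescaling to the η-lattice»), (3.56) p.662] -/
def kingDist (jv : KingVolIndex d) (x y : haveI := kingVol_neZero L jv; Tor (fine (L ^ jv.K) (kingVol L jv))) : ℝ :=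
  haveI := kingVol_neZero L jv
  tdistT (fine (L ^ jv.K) (kingVol L jv)) x y / (L : ℝ) ^ jv.K

/-- the unit-block distance is nonnegative. [folklore] -/
theorem kingDist_nonneg (jv : KingVolIndex d) (x y : haveI := kingVol_neZero L jv; Tor (fine (L ^ jv.K) (kingVol L jv))) :
    0 ≤ kingDist L jv x y := by
  haveI := kingVol_neZero L jv
  unfold kingDist
  exact div_nonneg (tdistT_nonneg _ x y) (pow_nonneg (Nat.cast_nonneg L) _)

/-- ★★★ **KING 1986 PROPOSITION 3.6 (3.56) WITH ITS EXPONENTIAL TREE DECAY, FOR CONNECTED GRAPHS UNDER POSITIVE DEGREES ALONG EVERY ORDERING, BY NAME AT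
`A = 0` — ONE `(C₁, C₂, γ₀, δ₁)`, UNIFORMLY IN THE MASS, THE VOLUME, THE SCALES, THE GRAPH AND THE EXTERNAL POINTS.**  For odd `L ≥ 3`, `a > 0`, `m₀² ≥ 0`
there are `C₁, C₂, γ₀, δ₁ > 0` such that for every mass `0 < m² ≤ m₀²`, index `jv` (torus `2L^{jv.m}`, `K = jv.K ≥ 1`), `n ≥ 1`, every CONNECTED numbered graph
(vertices `0, …, nn`; lines `src`, `tgt`, kinds `κ`, carrying King's full `A = 0` propagators `G^η_K`∕`∂^η_μG^η_K` and `G^{η′}_{K+n}`∕`∂^{η′}_μG^{η′}_{K+n}`), every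
anchoring `anch` of the one-vertex factors at points of `T_η` and leg rate `δ′ ≥ 0`, one-vertex factors with sizes `|u_υ(x)| ≤ qq_υ·e^{−δ′|x − y_υ|}` (both
lattices through the pairing; weight `1` if unanchored), rates `s_υqq_υ·e^{−δ′|x − y_υ|}`, a root-placed factor `υ₀` with pointwise majorants `p₀·(weight)`,
`r₀·(weight)` of `L¹` norms `≤ Γ, Γ′`, every margin `γ₁ > 0` and certificates with partial degrees `> γ₁` along every ordering:
`|E^{(K+n)}(H) − E^{(K)}(H)| ≤ exp[−min(δ₁, δ′)·treeLength |·| {y_υ}]·(Γ′ + Γ·(L^{−γK}(m+1) + Σ_{υ≠υ₀} s_υ))·C₁^m·C₂^{nn}·(m!·(1 − L^{−γ₁∕2})^{−m})·Π_{υ≠υ₀} qq_υ`,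
`γ = min(γ₀, γ₁∕2)` — part Γ-i's bound TIMES THE TREE DECAY OF THE EXTERNAL POINTS.
[cite: King1986, Prop. 3.6 (3.56) p.662, p.660 («the length of the shortest tree graph connecting {u_i}»), p.664 («By extracting a small part of each propagator,
we get the exponential decay on the right-hand side of (3.56)»), pp.663–665, Prop. 3.7 (3.63) p.663, Prop. 3.9 (3.73) p.665] -/
theorem king_prop36_graph_zeroField_treeDecay_R (hLodd : Odd L) (hL : 2 ≤ L) {a : ℝ} (ha : 0 < a) {m0sq : ℝ} (hm0 : 0 ≤ m0sq) :
    ∃ C₁ C₂ γ₀ δ₁ : ℝ, 0 < C₁ ∧ 0 < C₂ ∧ 0 < γ₀ ∧ 0 < δ₁ ∧ ∀ (msq : ℝ), 0 < msq → msq ≤ m0sq → ∀ (jv : KingVolIndex d) (n : ℕ), 1 ≤ n →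
      ∀ (nn m : ℕ) (src tgt : Fin m → Fin (nn + 1)), (∀ v, LConn src tgt univ 0 v) →
      ∀ (κ : Fin m → Option (Fin (d + 1))) (Υ : Type) [Fintype Υ] [DecidableEq Υ]
        (vtx : Υ → Fin (nn + 1)) (υ₀ : Υ), vtx υ₀ = 0 →
        haveI := kingVol_neZero L jv
        ∀ (anch : Υ → Option (Tor (fine (L ^ jv.K) (kingVol L jv)))) (δ' : ℝ), 0 ≤ δ' →
        ∀ (u : Υ → Tor (fine (L ^ jv.K) (kingVol L jv)) → ℝ) (u' : Υ → Tor (fine (L ^ (jv.K + n)) (kingVol L jv)) → ℝ)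
          (qq s : Υ → ℝ) (p₀ r₀ : Tor (fine (L ^ jv.K) (kingVol L jv)) → ℝ) (Γ Γ' γ₁ : ℝ),
          (∀ υ, 0 ≤ qq υ) → (∀ υ, 0 ≤ s υ) → (∀ x, 0 ≤ p₀ x) → (∀ x, 0 ≤ r₀ x) →
          (∀ υ, υ ≠ υ₀ → ∀ x, |u υ x| ≤ qq υ * legWeight δ' (kingDist L jv) (anch υ) x) →
          (∀ υ, υ ≠ υ₀ → ∀ x', |u' υ x'| ≤ qq υ * legWeight δ' (kingDist L jv) (anch υ) (kingSlicePt L jv.K n (kingVol L jv) x')) →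
          (∀ υ, υ ≠ υ₀ → ∀ x', |u' υ x' - u υ (kingSlicePt L jv.K n (kingVol L jv) x')|
              ≤ s υ * qq υ * legWeight δ' (kingDist L jv) (anch υ) (kingSlicePt L jv.K n (kingVol L jv) x')) →
          (∀ x, |u υ₀ x| ≤ p₀ x * legWeight δ' (kingDist L jv) (anch υ₀) x) →
          (∀ x', |u' υ₀ x'| ≤ p₀ (kingSlicePt L jv.K n (kingVol L jv) x') * legWeight δ' (kingDist L jv) (anch υ₀) (kingSlicePt L jv.K n (kingVol L jv) x')) →
          (∀ x', |u' υ₀ x' - u υ₀ (kingSlicePt L jv.K n (kingVol L jv) x')|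
              ≤ r₀ (kingSlicePt L jv.K n (kingVol L jv) x') * legWeight δ' (kingDist L jv) (anch υ₀) (kingSlicePt L jv.K n (kingVol L jv) x')) →
          (∑ x, (((L : ℝ) ^ jv.K)⁻¹) ^ (d + 1) * p₀ x ≤ Γ) → (∑ x, (((L : ℝ) ^ jv.K)⁻¹) ^ (d + 1) * r₀ x ≤ Γ') → 0 < γ₁ →
          ∀ cert : Equiv.Perm (Fin m) → ForestCertR nn src tgt,
            (∀ π, PosDegreesBy γ₁ (orderList ((d + 1 : ℕ) : ℝ) (fun ℓ => lineExp (d + 1) (κ ℓ)) π (cert π).F)) →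
            |graphValLS ((((L : ℝ) ^ (jv.K + n))⁻¹) ^ (d + 1)) src tgt (fun ℓ => kingGLine L (kingVol L jv) a msq (jv.K + n) (κ ℓ)) vtx u'
                - graphValLS ((((L : ℝ) ^ jv.K)⁻¹) ^ (d + 1)) src tgt (fun ℓ => kingGLine L (kingVol L jv) a msq jv.K (κ ℓ)) vtx u|
              ≤ Real.exp (-(min δ₁ δ' * treeLength (kingDist L jv) (anchors anch)))
                * ((Γ' + Γ * ((L : ℝ) ^ (-(min γ₀ (γ₁ / 2) * jv.K)) * (m + 1) + ∑ υ ∈ univ.erase υ₀, s υ))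
                  * (C₁ ^ m * C₂ ^ nn * ((m.factorial : ℝ) * ((1 - (L : ℝ) ^ (-(γ₁ / 2)))⁻¹) ^ m) * ∏ υ ∈ univ.erase υ₀, qq υ)) := by
  classical
  obtain ⟨CA, δA, hCA, hδA, HA⟩ := prop37PrintedAt_king_zeroField (d := d) L hLodd hL ha hm0 (α := 1 / 2) (by norm_num) (by norm_num)
  obtain ⟨CB, δB, γB, hCB, hδB, hγB, HB⟩ := king_graph_replacement_zeroField_decay (d := d) L hLodd hL ha hm0 (α := 1 / 2) (by norm_num) (by norm_num)
  have hδA2 : 0 < δA / 2 := by linarith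
  refine ⟨max (CA * Real.exp (δA / 2)) CB, max (c368 d (δA / 2)) (c368 d δB), γB, min (δA / 2) δB,
    lt_max_of_lt_left (by positivity), lt_max_of_lt_left (c368_pos d hδA2), hγB, lt_min hδA2 hδB,
    fun msq hm hcap jv n hn nn m src tgt hconn κ Υ _ _ vtx υ₀ hυ₀ anch δ' hδ' u u' qq s p₀ r₀ Γ Γ' γ₁ hqq hs hp₀0 hr₀ hu hu' hus hp₀ hp₀' hr₀'
      hΓ hΓ' hγ₁ cert hmar => ?_⟩
  haveI := kingVol_neZero L jv
  -- letters
  have hL1 : 1 ≤ L := by omega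
  have hL0 : (0 : ℝ) < L := by exact_mod_cast (show 0 < L by omega)
  have hL1r : (1 : ℝ) ≤ L := by exact_mod_cast hL1
  have hK : 1 ≤ jv.K := jv.one_le_K
  set γ : ℝ := min γB (γ₁ / 2) with hγdef
  have hγ0 : 0 ≤ γ := le_min hγB.le (by linarith)
  have hγB' : γ ≤ γB := min_le_left _ _
  have hγ1 : γ ≤ γ₁ / 2 := min_le_right _ _
  set C₁ := max (CA * Real.exp (δA / 2)) CB with hC₁
  set C₂ := max (c368 d (δA / 2)) (c368 d δB) with hC₂
  have hCA1 : CA * Real.exp (δA / 2) ≤ C₁ := le_max_left _ _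
  have hCB1 : CB ≤ C₁ := le_max_right _ _
  have hcA2 : c368 d (δA / 2) ≤ C₂ := le_max_left _ _
  have hcB2 : c368 d δB ≤ C₂ := le_max_right _ _
  have hC₁0 : 0 ≤ C₁ := hCB.le.trans hCB1
  have hC₂0 : 0 ≤ C₂ := (c368_pos d hδB).le.trans hcB2
  set w : ℝ := (((L : ℝ) ^ jv.K)⁻¹) ^ (d + 1) with hw
  set w' : ℝ := (((L : ℝ) ^ (jv.K + n))⁻¹) ^ (d + 1) with hw'
  have hw0 : 0 ≤ w := by positivity
  have hw0' : 0 ≤ w' := by positivity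
  set e : Fin m → ℝ := fun ℓ => lineExp (d + 1) (κ ℓ) with he
  set pt := kingSlicePt L jv.K n (kingVol L jv) with hptdef
  -- the weights: `δ⋆ = min(δ₁, δ′)`, line weights `exp[−δ⋆|x − y|]`, leg weights `legWeight δ⋆`, `Θ₀ = exp[−δ⋆·treeLength]`
  set ρ := kingDist L jv with hρdef
  have hρ0 : ∀ x y, 0 ≤ ρ x y := fun x y => kingDist_nonneg L jv x y
  set δs : ℝ := min (min (δA / 2) δB) δ' with hδs
  have hδs0 : 0 ≤ δs := le_min (le_min hδA2.le hδB.le) hδ'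
  have hδsA : δs ≤ δA / 2 := (min_le_left _ _).trans (min_le_left _ _)
  have hδsB : δs ≤ δB := (min_le_left _ _).trans (min_le_right _ _)
  have hδs' : δs ≤ δ' := min_le_right _ _
  set ϑ : Υ → Tor (fine (L ^ jv.K) (kingVol L jv)) → ℝ := fun υ x => legWeight δs ρ (anch υ) x with hϑdef
  have hϑpos : ∀ υ x, 0 < ϑ υ x := fun υ x => legWeight_pos δs ρ (anch υ) x
  have hϑle : ∀ υ x, legWeight δ' ρ (anch υ) x ≤ ϑ υ x := fun υ x => legWeight_anti hδs' hρ0 (anch υ) x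
  set Θ₀ : ℝ := Real.exp (-(δs * treeLength ρ (anchors anch))) with hΘ₀
  have hΘ0 : 0 ≤ Θ₀ := Real.exp_nonneg _
  have hΘ : ∀ σ : Fin (nn + 1) → Tor (fine (L ^ jv.K) (kingVol L jv)),
      (∏ ℓ, Real.exp (-(δs * (tdistT (fine (L ^ jv.K) (kingVol L jv)) (σ (src ℓ)) (σ (tgt ℓ)) / (L : ℝ) ^ jv.K))))
        * ∏ υ, ϑ υ (σ (vtx υ)) ≤ Θ₀ := fun σ =>
    prod_lineWeight_mul_prod_legWeight_le src tgt vtx anch hδs0 hρ0 hconn σ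
  -- the stripped one-vertex majorants against the weights `ϑ`
  have hstrip : ∀ (υ : Υ) (t c : ℝ) (x : Tor (fine (L ^ jv.K) (kingVol L jv))), 0 ≤ c → t ≤ c * legWeight δ' ρ (anch υ) x → t ≤ c * ϑ υ x :=
    fun υ t c x hc h => h.trans (mul_le_mul_of_nonneg_left (hϑle υ x) hc)
  have hsq0 : ∀ υ, 0 ≤ s υ * qq υ := fun υ => mul_nonneg (hs υ) (hqq υ)
  -- the degree constants under the margin
  set Dst : ℝ := (m.factorial : ℝ) * ((1 - (L : ℝ) ^ (-(γ₁ / 2)))⁻¹) ^ m with hDst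
  have hlen : ∀ (f : Fin m → ℝ), (List.ofFn f).length = m := fun f => List.length_ofFn
  have hD0 : ∑ π : Equiv.Perm (Fin m), degConst L (orderList ((d + 1 : ℕ) : ℝ) e π (cert π).F) ≤ Dst :=
    sum_degConst_le_of_margin L hL hγ₁ hγ1 _ fun π => ⟨posDegreesBy_mono (by linarith) (hmar π), hlen _⟩
  have hDℓ : ∀ ℓ : Fin m, ∑ π : Equiv.Perm (Fin m), degConst L (orderList ((d + 1 : ℕ) : ℝ) (Function.update e ℓ (e ℓ - γ)) π (cert π).F) ≤ Dst :=
    fun ℓ => sum_degConst_le_of_margin L hL hγ₁ hγ1 _ fun π => ⟨posDegreesBy_orderList_update hγ0 _ e ℓ π (cert π).F (hmar π), hlen _⟩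
  have hDA : ∑ π : Equiv.Perm (Fin m), degConst L (List.ofFn fun p : Fin m => lowerFinest γ (orderExps ((d + 1 : ℕ) : ℝ) e π (cert π).F) (Fin.rev p)) ≤ Dst :=
    sum_degConst_le_of_margin L hL hγ₁ hγ1 _ fun π => ⟨posDegreesBy_orderList_lowerFinest hγ0 _ e π (cert π).F (hmar π), hlen _⟩
  have hpos0 : ∀ π, PosDegrees (orderList ((d + 1 : ℕ) : ℝ) e π (cert π).F) := fun π => posDegrees_of_posDegreesBy hγ₁.le (hmar π)
  have hposℓ : ∀ (ℓ : Fin m) π, PosDegrees (orderList ((d + 1 : ℕ) : ℝ) (Function.update e ℓ (e ℓ - γ)) π (cert π).F) := fun ℓ π =>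
    posDegrees_of_posDegreesBy (by linarith) (posDegreesBy_orderList_update hγ0 _ e ℓ π (cert π).F (hmar π))
  have hposA : ∀ π, PosDegrees (List.ofFn fun p : Fin m => lowerFinest γ (orderExps ((d + 1 : ℕ) : ℝ) e π (cert π).F) (Fin.rev p)) := fun π =>
    posDegrees_of_posDegreesBy (by linarith) (posDegreesBy_orderList_lowerFinest hγ0 _ e π (cert π).F (hmar π))
  -- the pairing
  have hfib := card_filter_kingSlicePt L jv.K n (kingVol L jv)
  have hwr := king_weight_repair (d := d) L hL0 jv.K n
  have hΓ0 : 0 ≤ Γ := (sum_nonneg fun x _ => mul_nonneg hw0 (hp₀0 x)).trans hΓ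
  have hΓ'0 : 0 ≤ Γ' := (sum_nonneg fun x _ => mul_nonneg hw0 (hr₀ x)).trans hΓ'
  have hqq0 : 0 ≤ ∏ υ ∈ univ.erase υ₀, qq υ := prod_nonneg fun υ _ => hqq υ
  -- constants of the statement
  set B0 : ℝ := C₁ ^ m * C₂ ^ nn * ∏ υ ∈ univ.erase υ₀, qq υ with hB0
  have hDst0 : 0 ≤ Dst := le_trans (sum_nonneg fun π _ => zero_le_one.trans (one_le_degConst L hL (hpos0 π))) hD0
  set θ : ℝ := (L : ℝ) ^ (-(γ * jv.K)) with hθ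
  have hθ0 : 0 ≤ θ := Real.rpow_nonneg hL0.le _
  have hθA : (L : ℝ) ^ (-(γ * (jv.K + 1 : ℕ))) ≤ θ := by
    refine Real.rpow_le_rpow_of_exponent_le hL1r ?_
    push_cast
    nlinarith [hγ0]
  have hkey : ∀ (G D : ℝ), 0 ≤ G → D ≤ Dst → G * (C₁ ^ m * C₂ ^ nn * D * ∏ υ ∈ univ.erase υ₀, qq υ) ≤ G * (B0 * Dst) := by
    intro G D hG hD
    refine mul_le_mul_of_nonneg_left ?_ hG
    rw [hB0, show C₁ ^ m * C₂ ^ nn * D * ∏ υ ∈ univ.erase υ₀, qq υ = (C₁ ^ m * C₂ ^ nn * ∏ υ ∈ univ.erase υ₀, qq υ) * D by ring]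
    exact mul_le_mul_of_nonneg_left hD (mul_nonneg (mul_nonneg (pow_nonneg hC₁0 _) (pow_nonneg hC₂0 _)) hqq0)
  -- the stripped one-vertex majorants fed to part Α-d
  set p : Υ → Tor (fine (L ^ jv.K) (kingVol L jv)) → ℝ := fun υ x => if υ = υ₀ then p₀ x else qq υ with hpdef
  set q : Υ → Tor (fine (L ^ jv.K) (kingVol L jv)) → ℝ := fun υ x => if υ = υ₀ then r₀ x else s υ * qq υ with hqdef
  have hp0 : ∀ υ x, 0 ≤ p υ x := fun υ x => by
    by_cases h : υ = υ₀
    · subst h; simp only [hpdef, if_true]; exact hp₀0 x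
    · simp only [hpdef, if_neg h]; exact hqq υ
  have hq0 : ∀ υ x, 0 ≤ q υ x := fun υ x => by
    by_cases h : υ = υ₀
    · subst h; simp only [hqdef, if_true]; exact hr₀ x
    · simp only [hqdef, if_neg h]; exact hsq0 υ
  have hpn : ∀ υ x, ‖u υ x‖ ≤ p υ x * ϑ υ x := fun υ x => by
    rw [Real.norm_eq_abs]
    by_cases h : υ = υ₀
    · subst h; simp only [hpdef, if_true]; exact hstrip _ _ _ x (hp₀0 x) (hp₀ x)
    · simp only [hpdef, if_neg h]; exact hstrip _ _ _ x (hqq υ) (hu υ h x)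
  have hpn' : ∀ υ x', ‖u' υ x'‖ ≤ p υ (pt x') * ϑ υ (pt x') := fun υ x' => by
    rw [Real.norm_eq_abs]
    by_cases h : υ = υ₀
    · subst h; simp only [hpdef, if_true]; exact hstrip _ _ _ _ (hp₀0 _) (hp₀' x')
    · simp only [hpdef, if_neg h]; exact hstrip _ _ _ _ (hqq υ) (hu' υ h x')
  have hqn : ∀ υ x', ‖u' υ x' - u υ (pt x')‖ ≤ q υ (pt x') * ϑ υ (pt x') := fun υ x' => by
    rw [Real.norm_eq_abs]
    by_cases h : υ = υ₀
    · subst h; simp only [hqdef, if_true]; exact hstrip _ _ _ _ (hr₀ _) (hr₀' x')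
    · simp only [hqdef, if_neg h]; exact hstrip _ _ _ _ (hsq0 υ) (hus υ h x')
  have hpq : ∀ υ, υ ≠ υ₀ → ∀ x, p υ x ≤ qq υ := fun υ h x => by simp only [hpdef, if_neg h]; exact le_rfl
  have hpΓ : ∑ x, w * p υ₀ x ≤ Γ := by simpa only [hpdef, if_true] using hΓ
  have hΓf : ∑ x', w' * p υ₀ (pt x') ≤ Γ := by
    rw [sum_repaired (𝕜 := ℝ) pt hfib hwr (p υ₀)]; exact hpΓ
  -- Prop. 3.7 of the fine run; (2.17) multiplied out on both lattices; the `S ∕ S^c` split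
  have h37' := HA (jv.K + n) jv.m (one_le_add_of_one_le hK n) (kingVol L jv) (fun _ => rfl) msq hm hcap
  rw [graphValLS_kingGLine_eq_sum L hL ha (one_le_add_of_one_le hK n) (kingVol L jv) (fun _ => rfl) hm w' src tgt κ vtx u',
    graphValLS_kingGLine_eq_sum L hL ha hK (kingVol L jv) (fun _ => rfl) hm w src tgt κ vtx u,
    sum_assign_split m jv.K n]
  -- PART A: the `S^c` terms, with the decay extracted (part Α-d)
  have hA := king_graph_finest_small_decay_R L hL hK hn (kingVol L jv) (fun _ => rfl) hCA.le hδA hδs0 hδsA hCA1 hcA2 h37' src tgt κ vtx u'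
    ϑ (fun υ x => (hϑpos υ x).le) (fun υ x' => p υ (pt x')) (fun υ x' => hp0 υ _)
    (fun υ x' => by have h := hpn' υ x'; rwa [Real.norm_eq_abs] at h) qq υ₀ hυ₀ (fun υ h x' => hpq υ h _) hΓf (Θ₀ := Θ₀) hΘ cert hγ0 hposA
  -- PART B: the `S` terms, one assignment at a time (part Α-d), then «γ small enough» and the power counting of every replaced graph
  have hBj : ∀ j : Fin m → Fin jv.K,
      |graphValLS w' src tgt (fun ℓ (x' y' : Tor (fine (L ^ (jv.K + n)) (kingVol L jv))) =>
            sliceLine (kingSliceKernels L (jv.K + n) jv.m (kingVol L jv) (fun _ => rfl) (one_le_add_of_one_le hK n) a msq)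
              (((fun ℓ => Fin.addNat (j ℓ) n) ℓ : Fin (jv.K + n)) : ℕ) (κ ℓ) x' y') vtx u'
        - graphValLS w src tgt (fun ℓ (x y : Tor (fine (L ^ jv.K) (kingVol L jv))) =>
            sliceLine (kingSliceKernels L jv.K jv.m (kingVol L jv) (fun _ => rfl) hK a msq) (j ℓ) (κ ℓ) x y) vtx u|
      ≤ Θ₀ * (θ * ∑ ℓ, graphValLS w src tgt (fun ℓ' (x y : Tor (fine (L ^ jv.K) (kingVol L jv))) =>
            profileAt L jv.K (kingVol L jv) CB δB (j ℓ') (Function.update e ℓ (e ℓ - γ) ℓ') x y) vtx p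
        + ∑ υ, graphValLS w src tgt (fun ℓ' (x y : Tor (fine (L ^ jv.K) (kingVol L jv))) =>
            profileAt L jv.K (kingVol L jv) CB δB (j ℓ') (e ℓ') x y) vtx (Function.update p υ (q υ))) := by
    intro j
    have h := HB msq hm hcap jv n hn (Fin (nn + 1)) (Fin m) Υ src tgt (fun ℓ => ((j ℓ : ℕ))) (fun ℓ => (j ℓ).isLt) κ vtx δs hδs0 hδsB u u' ϑ p q
      hϑpos hp0 hq0 hpn hpn' hqn Θ₀ hΘ
    have hhi : (fun ℓ (x' y' : Tor (fine (L ^ (jv.K + n)) (kingVol L jv))) =>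
          sliceLine (kingSliceKernels L (jv.K + n) jv.m (kingVol L jv) (fun _ => rfl) (one_le_add_of_one_le hK n) a msq)
            (((fun ℓ => Fin.addNat (j ℓ) n) ℓ : Fin (jv.K + n)) : ℕ) (κ ℓ) x' y')
        = fun ℓ => kingHiLine L a msq jv n ((j ℓ : ℕ)) (κ ℓ) := by
      funext ℓ x' y'; rw [kingHiLine_eq_sliceLine]; rfl
    have hlo : (fun ℓ (x y : Tor (fine (L ^ jv.K) (kingVol L jv))) =>
          sliceLine (kingSliceKernels L jv.K jv.m (kingVol L jv) (fun _ => rfl) hK a msq) (j ℓ) (κ ℓ) x y)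
        = fun ℓ => kingLoLine L a msq jv n ((j ℓ : ℕ)) (κ ℓ) := by
      funext ℓ x y; rw [kingLoLine_eq_sliceLine]
    rw [hhi, hlo, ← Real.norm_eq_abs]
    refine h.trans (mul_le_mul_of_nonneg_left (add_le_add ?_ (le_of_eq rfl)) hΘ0)
    rw [mul_sum, mul_sum]
    exact sum_le_sum fun ℓ _ => replacement_line_term_le L (kingVol L jv) hCB.le hγB' src tgt vtx κ p hp0 j ℓ
  -- the replaced graphs summed over the assignments
  have hTℓ : ∀ ℓ : Fin m, ∑ j : Fin m → Fin jv.K, graphValLS w src tgt (fun ℓ' (x y : Tor (fine (L ^ jv.K) (kingVol L jv))) =>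
        profileAt L jv.K (kingVol L jv) CB δB (j ℓ') (Function.update e ℓ (e ℓ - γ) ℓ') x y) vtx p ≤ Γ * (B0 * Dst) := by
    intro ℓ
    refine (sum_graphValLS_profileAt_le_R L hL hK (kingVol L jv) hCB.le hδB hCB1 hcB2 vtx (Function.update e ℓ (e ℓ - γ)) p hp0 υ₀ hυ₀ hpΓ qq hpq
      cert (hposℓ ℓ)).trans (hkey Γ _ hΓ0 (hDℓ ℓ))
  have hU0 : ∑ j : Fin m → Fin jv.K, graphValLS w src tgt (fun ℓ' (x y : Tor (fine (L ^ jv.K) (kingVol L jv))) =>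
        profileAt L jv.K (kingVol L jv) CB δB (j ℓ') (e ℓ') x y) vtx (Function.update p υ₀ (q υ₀)) ≤ Γ' * (B0 * Dst) := by
    have hp0' : ∀ υ x, 0 ≤ Function.update p υ₀ (q υ₀) υ x := fun υ x => by
      by_cases h : υ = υ₀
      · subst h; rw [Function.update_self]; exact hq0 _ x
      · rw [Function.update_of_ne h]; exact hp0 υ x
    have hΓ'' : ∑ x, w * Function.update p υ₀ (q υ₀) υ₀ x ≤ Γ' := by
      simpa only [Function.update_self, hqdef, if_true] using hΓ'
    have hq' : ∀ υ, υ ≠ υ₀ → ∀ x, Function.update p υ₀ (q υ₀) υ x ≤ qq υ := fun υ h x => by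
      rw [Function.update_of_ne h]; exact hpq υ h x
    exact (sum_graphValLS_profileAt_le_R L hL hK (kingVol L jv) hCB.le hδB hCB1 hcB2 vtx e _ hp0' υ₀ hυ₀ hΓ'' qq hq' cert hpos0).trans
      (hkey Γ' _ hΓ'0 hD0)
  have hUυ : ∀ υ, υ ≠ υ₀ → ∑ j : Fin m → Fin jv.K, graphValLS w src tgt (fun ℓ' (x y : Tor (fine (L ^ jv.K) (kingVol L jv))) =>
        profileAt L jv.K (kingVol L jv) CB δB (j ℓ') (e ℓ') x y) vtx (Function.update p υ (q υ)) ≤ Γ * (B0 * Dst) * s υ := by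
    intro υ hυ
    have hp0' : ∀ υ' x, 0 ≤ Function.update p υ (q υ) υ' x := fun υ' x => by
      by_cases h : υ' = υ
      · subst h; rw [Function.update_self]; exact hq0 _ x
      · rw [Function.update_of_ne h]; exact hp0 υ' x
    have hΓ'' : ∑ x, w * Function.update p υ (q υ) υ₀ x ≤ Γ := by
      simpa only [Function.update_of_ne (Ne.symm hυ)] using hpΓ
    have hq' : ∀ υ', υ' ≠ υ₀ → ∀ x, Function.update p υ (q υ) υ' x ≤ Function.update qq υ (s υ * qq υ) υ' := fun υ' h x => by
      by_cases h' : υ' = υ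
      · subst h'; rw [Function.update_self, Function.update_self]; simp only [hqdef, if_neg hυ]; exact le_rfl
      · rw [Function.update_of_ne h', Function.update_of_ne h']; exact hpq υ' h x
    refine (sum_graphValLS_profileAt_le_R L hL hK (kingVol L jv) hCB.le hδB hCB1 hcB2 vtx e _ hp0' υ₀ hυ₀ hΓ'' _ hq' cert hpos0).trans ?_
    rw [prod_erase_update_mul qq υ₀ υ hυ (s υ),
      show Γ * (C₁ ^ m * C₂ ^ nn * (∑ π : Equiv.Perm (Fin m), degConst L (orderList ((d + 1 : ℕ) : ℝ) e π (cert π).F))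
          * (s υ * ∏ υ' ∈ univ.erase υ₀, qq υ'))
        = Γ * (C₁ ^ m * C₂ ^ nn * (∑ π : Equiv.Perm (Fin m), degConst L (orderList ((d + 1 : ℕ) : ℝ) e π (cert π).F))
          * ∏ υ' ∈ univ.erase υ₀, qq υ') * s υ by ring]
    exact mul_le_mul_of_nonneg_right (hkey Γ _ hΓ0 hD0) (hs υ)
  -- PART A's constant under the margin
  have hA' : Θ₀ * ((L : ℝ) ^ (-(γ * (jv.K + 1 : ℕ))) * (Γ * (C₁ ^ m * C₂ ^ nn
      * (∑ π : Equiv.Perm (Fin m), degConst L (List.ofFn fun pp : Fin m => lowerFinest γ (orderExps ((d + 1 : ℕ) : ℝ) e π (cert π).F) (Fin.rev pp)))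
      * ∏ υ ∈ univ.erase υ₀, qq υ))) ≤ Θ₀ * (θ * (Γ * (B0 * Dst))) := by
    refine mul_le_mul_of_nonneg_left ?_ hΘ0
    exact mul_le_mul hθA (hkey Γ _ hΓ0 hDA) (mul_nonneg hΓ0 (mul_nonneg (mul_nonneg (mul_nonneg (pow_nonneg hC₁0 _) (pow_nonneg hC₂0 _))
      (sum_nonneg fun π _ => zero_le_one.trans (one_le_degConst L hL (hposA π)))) hqq0)) hθ0
  -- assemble
  have hsplit_abs : ∀ (A S1 S0 : ℝ), |A + S1 - S0| ≤ |A| + |S1 - S0| := fun A S1 S0 => by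
    rw [add_sub_assoc]; exact abs_add_le _ _
  refine (hsplit_abs _ _ _).trans ?_
  have hAabs : |∑ j' : Fin m → Fin (jv.K + n), (if ∃ ℓ, ((j' ℓ : ℕ)) < n then
        graphValLS w' src tgt (fun ℓ (x' y' : Tor (fine (L ^ (jv.K + n)) (kingVol L jv))) =>
          sliceLine (kingSliceKernels L (jv.K + n) jv.m (kingVol L jv) (fun _ => rfl) (one_le_add_of_one_le hK n) a msq) (j' ℓ) (κ ℓ) x' y')
          vtx u' else 0)|
      ≤ Θ₀ * (θ * (Γ * (B0 * Dst))) := by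
    refine (abs_sum_le_sum_abs _ _).trans (le_trans (le_trans (sum_le_sum fun j' _ => le_of_eq ?_) hA) hA')
    split_ifs
    · rfl
    · exact abs_zero
  have hBabs : |∑ j : Fin m → Fin jv.K, graphValLS w' src tgt (fun ℓ (x' y' : Tor (fine (L ^ (jv.K + n)) (kingVol L jv))) =>
          sliceLine (kingSliceKernels L (jv.K + n) jv.m (kingVol L jv) (fun _ => rfl) (one_le_add_of_one_le hK n) a msq)
            (((fun ℓ => Fin.addNat (j ℓ) n) ℓ : Fin (jv.K + n)) : ℕ) (κ ℓ) x' y') vtx u'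
        - ∑ j : Fin m → Fin jv.K, graphValLS w src tgt (fun ℓ (x y : Tor (fine (L ^ jv.K) (kingVol L jv))) =>
          sliceLine (kingSliceKernels L jv.K jv.m (kingVol L jv) (fun _ => rfl) hK a msq) (j ℓ) (κ ℓ) x y) vtx u|
      ≤ Θ₀ * (θ * (m * (Γ * (B0 * Dst))) + (Γ' * (B0 * Dst) + Γ * (B0 * Dst) * ∑ υ ∈ univ.erase υ₀, s υ)) := by
    rw [← sum_sub_distrib]
    refine (abs_sum_le_sum_abs _ _).trans ((sum_le_sum fun j _ => hBj j).trans ?_)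
    rw [← mul_sum]
    refine mul_le_mul_of_nonneg_left ?_ hΘ0
    rw [sum_add_distrib, ← mul_sum]
    refine add_le_add (mul_le_mul_of_nonneg_left ?_ hθ0) ?_
    · rw [sum_comm]
      calc ∑ ℓ : Fin m, ∑ j : Fin m → Fin jv.K, graphValLS w src tgt (fun ℓ' (x y : Tor (fine (L ^ jv.K) (kingVol L jv))) =>
              profileAt L jv.K (kingVol L jv) CB δB (j ℓ') (Function.update e ℓ (e ℓ - γ) ℓ') x y) vtx p
          ≤ ∑ _ℓ : Fin m, Γ * (B0 * Dst) := sum_le_sum fun ℓ _ => hTℓ ℓ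
        _ = m * (Γ * (B0 * Dst)) := by rw [sum_const, card_univ, Fintype.card_fin, nsmul_eq_mul]
    · rw [sum_comm, ← add_sum_erase univ _ (mem_univ υ₀), mul_sum]
      exact add_le_add hU0 (sum_le_sum fun υ hυ => hUυ υ (ne_of_mem_erase hυ))
  refine (add_le_add hAabs hBabs).trans (le_of_eq ?_)
  rw [hB0, hDst]
  ring

end Prop36TreeDecay

end Summit.QuantumFields.YangMills.BalabanUVNodes.N15KingModelRung.Curved

end
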